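import Summits.AtomisticToContinuum.HydrodynamicLimit.Theorems.StiffCollisionalRelaxationAprioriBoundsFloorChain
import Summits.AtomisticToContinuum.HydrodynamicLimit.Theorems.StiffCollisionalRelaxationAprioriBoundsEnergyCap
import Summits.AtomisticToContinuum.HydrodynamicLimit.Theorems.StiffCollisionalRelaxationAprioriBoundsBlockModulus
import Summits.AtomisticToContinuum.HydrodynamicLimit.Theorems.StiffCollisionalRelaxationAprioriBoundsColdJam
import Summits.AtomisticToContinuum.HydrodynamicLimit.Theorems.StiffCollisionalRelaxationAprioriBoundsHotJam
import HarnessLib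

/-!
# From a fixed-point packing bound to the uniform half-ceiling, and to the two jam stubs

Supporting file of the line `Sketch` (card `adiabat-pricing-of-the-ceiling`) for the crux `AprioriBounds`
(stmt-AtomisticToContinuum-14827), lead prover `prover-line-stmt-AtomisticToContinuum-14827-c1-0`: a third DOCKING
ROUTE for the open ceiling stubs `stub_coldJam` / `stub_hotJam`.  Both follow (landed `coldJam_of_halfCeiling`,
`hotJam_of_halfCeiling`) from the level-`1` half-ceiling along the flow,
`P_N{∃ s ≤ t, ∃ x, 1 < ρ̄_N(s,x)σ³} → 0`; this file shows that the half-ceiling in turn follows from a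
FIXED-`(s, x)` packing bound at HALF the level, `P_N{1/2 < ρ̄_N(s,x)σ³} ≤ δ_N` with `(N+1)²δ_N → 0`, by the
same space–time grid + union bound as the floor (`stub_floorChain`) — applied to the reflected field
`F := 3/2 − ρ̄σ³` (`{F < 1} = {1/2 < ρ̄σ³}`, `{F < 1/2} = {1 < ρ̄σ³}`), whose modulus is `σ³` times that of
`ρ̄` (`stub_blockModulus`), the energy cap coming from the prefix (`stub_energyCap`).

* `ceilingChain` — abstract form over any family of laws (mirror of `stub_floorChain`).
* `halfCeiling_of_ceilingFixed` — under the crux prefix: fixed-point half-level packing bound ⇒ half-ceiling.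
* `coldJam_of_ceilingFixed`, `hotJam_of_ceilingFixed` — the two registered jam stubs from the fixed-point bound.

No new definitions, no named facts; axioms `propext`, `Classical.choice`, `Quot.sound`.
-/

noncomputable section

open MeasureTheory Filter Set Topology
open scoped ENNReal

namespace Summit.AtomisticToContinuum.HydrodynamicLimit.Theorems.AdiabatCeiling

open Literature.MathematicalPhysics.KineticTheory Literature.Analysis.FluidPDE

/-- **Ceiling chaining** (mirror of `stub_floorChain`).  For ANY family of laws `P_N`: the space–time modulus
of the block densities on good orbits of energy `≤ K(N+1)` (Lipschitz constant `√3·C(N+1)^{4γ}` in the centre,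
`·√(2K)` in time), the cap `P_N{z ∉ good ∨ K(N+1) < E(z)} → 0` and a FIXED-`(s,x)` packing bound
`P_N{1/2 < ρ̄_N(Φ_s z, x)σ³} ≤ δ_N` with `(N+1)²δ_N → 0` give the uniform level-`1` half-ceiling
`P_N{∃ s ≤ t, ∃ x, 1 < ρ̄_N(Φ_s z, x)σ³} → 0` (`floorChain_measure_le` for `F = 3/2 − ρ̄σ³`, `c₁ = 1`,
grid `floorChain_exists_grid_params` with `C ↦ σ³C`). -/
theorem ceilingChain :
    ∀ (σ : ℝ) (Φ : (N : ℕ) → HardSphereFlow (Torus.geometry (Fin 3)) (hsDiameter σ N) (N + 1))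
      (P : (N : ℕ) → Measure (Config (N + 1) (Fin 3) T3))
      (φ : ℕ → T3 → ℝ) (γ C t K : ℝ) (δ : ℕ → ℝ),
      0 < γ → γ ≤ 1 / 15 → 0 ≤ C → 0 < t → 0 ≤ K → 0 ≤ σ →
      (∀ (N : ℕ), ∀ z ∈ (Φ N).good, configEnergy z ≤ K * ((N : ℝ) + 1) →
        ∀ (s s' : ℝ) (x x' : T3),
          |empiricalDensityField ((Φ N).flow s z) (fun y => φ N (y - x)) -
              empiricalDensityField ((Φ N).flow s' z) (fun y => φ N (y - x'))| ≤
            Real.sqrt 3 * (C * ((N : ℝ) + 1) ^ (4 * γ)) * (‖x - x'‖ + |s - s'| * Real.sqrt (2 * K))) →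
      Tendsto (fun N : ℕ => P N {z | z ∉ (Φ N).good ∨ K * ((N : ℝ) + 1) < configEnergy z}) atTop (𝓝 0) →
      Tendsto (fun N : ℕ => ((N : ℝ) + 1) ^ 2 * δ N) atTop (𝓝 0) →
      (∀ (N : ℕ), ∀ s ∈ Icc 0 t, ∀ x : T3,
        P N {z | 1 / 2 < empiricalDensityField ((Φ N).flow s z) (fun y => φ N (y - x)) * σ ^ 3} ≤
          ENNReal.ofReal (δ N)) →
      Tendsto (fun N : ℕ => P N {z | ∃ s ∈ Icc 0 t, ∃ x : T3,
        1 < empiricalDensityField ((Φ N).flow s z) (fun y => φ N (y - x)) * σ ^ 3}) atTop (𝓝 0) := by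
  intro σ Φ P φ γ C t K δ hγ hγ' hC ht hK hσ hmod hcap hδ hfix
  have hσ3 : 0 ≤ σ ^ 3 := pow_nonneg hσ 3
  have hC' : 0 ≤ σ ^ 3 * C := mul_nonneg hσ3 hC
  obtain ⟨A, hA, hgrid⟩ := floorChain_exists_grid_params (t := t) (c₁ := 1) K hγ hγ' hC' ht one_pos
  -- the reflected field and its modulus
  set F : (N : ℕ) → ℝ → Config (N + 1) (Fin 3) T3 → T3 → ℝ := fun N s z x =>
    3 / 2 - empiricalDensityField ((Φ N).flow s z) (fun y => φ N (y - x)) * σ ^ 3 with hF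
  have hmodF : ∀ N, ∀ z ∈ (Φ N).good, configEnergy z ≤ K * ((N : ℝ) + 1) →
      ∀ (s s' : ℝ) (x x' : T3), |F N s z x - F N s' z x'| ≤
        Real.sqrt 3 * (σ ^ 3 * C * ((N : ℝ) + 1) ^ (4 * γ)) * (‖x - x'‖ + |s - s'| * Real.sqrt (2 * K)) := by
    intro N z hz hE s s' x x'
    have h := hmod N z hz hE s s' x x'
    have hnn : 0 ≤ Real.sqrt 3 * (C * ((N : ℝ) + 1) ^ (4 * γ)) * (‖x - x'‖ + |s - s'| * Real.sqrt (2 * K)) :=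
      le_trans (abs_nonneg _) h
    have hdiff : F N s z x - F N s' z x' =
        -((empiricalDensityField ((Φ N).flow s z) (fun y => φ N (y - x)) -
            empiricalDensityField ((Φ N).flow s' z) (fun y => φ N (y - x'))) * σ ^ 3) := by
      rw [hF]
      ring
    calc |F N s z x - F N s' z x'|
        = |empiricalDensityField ((Φ N).flow s z) (fun y => φ N (y - x)) -
            empiricalDensityField ((Φ N).flow s' z) (fun y => φ N (y - x'))| * σ ^ 3 := by
          rw [hdiff, abs_neg, abs_mul, abs_of_nonneg hσ3]
      _ ≤ Real.sqrt 3 * (C * ((N : ℝ) + 1) ^ (4 * γ)) * (‖x - x'‖ + |s - s'| * Real.sqrt (2 * K)) * σ ^ 3 :=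
          mul_le_mul_of_nonneg_right h hσ3
      _ = Real.sqrt 3 * (σ ^ 3 * C * ((N : ℝ) + 1) ^ (4 * γ)) * (‖x - x'‖ + |s - s'| * Real.sqrt (2 * K)) := by
          ring
  -- the events of `F`
  have hevF1 : ∀ N s z x, F N s z x < 1 ↔
      1 / 2 < empiricalDensityField ((Φ N).flow s z) (fun y => φ N (y - x)) * σ ^ 3 := by
    intro N s z x
    rw [hF]
    dsimp only
    constructor <;> intro h <;> linarith
  have hevF2 : ∀ N s z x, F N s z x < 1 / 2 ↔
      1 < empiricalDensityField ((Φ N).flow s z) (fun y => φ N (y - x)) * σ ^ 3 := by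
    intro N s z x
    rw [hF]
    dsimp only
    constructor <;> intro h <;> linarith
  -- the bound at every `N`
  have hbound : ∀ N : ℕ,
      P N {z | ∃ s ∈ Icc 0 t, ∃ x : T3,
          1 < empiricalDensityField ((Φ N).flow s z) (fun y => φ N (y - x)) * σ ^ 3} ≤
        P N {z | z ∉ (Φ N).good ∨ K * ((N : ℝ) + 1) < configEnergy z} +
          ENNReal.ofReal (A * (((N : ℝ) + 1) ^ 2 * |δ N|)) := by
    intro N
    obtain ⟨m, h, hm, hh, hsp, hti, hcard⟩ := hgrid N
    have hset : {z | ∃ s ∈ Icc 0 t, ∃ x : T3,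
        1 < empiricalDensityField ((Φ N).flow s z) (fun y => φ N (y - x)) * σ ^ 3} =
        {z | ∃ s ∈ Icc 0 t, ∃ x : T3, F N s z x < 1 / 2} := by
      ext z
      simp only [mem_setOf_eq, hevF2]
    rw [hset]
    have hsp' : Real.sqrt 3 * (σ ^ 3 * C * ((N : ℝ) + 1) ^ (4 * γ)) * (1 / (m : ℝ)) ≤ 1 / 4 := by
      have : Real.sqrt 3 * (σ ^ 3 * C * ((N : ℝ) + 1) ^ (4 * γ)) =
          Real.sqrt 3 * ((σ ^ 3 * C) * ((N : ℝ) + 1) ^ (4 * γ)) := by ring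
      rw [this]
      exact hsp
    have hti' : Real.sqrt 3 * (σ ^ 3 * C * ((N : ℝ) + 1) ^ (4 * γ)) * Real.sqrt (2 * K) * h ≤ 1 / 4 := by
      have : Real.sqrt 3 * (σ ^ 3 * C * ((N : ℝ) + 1) ^ (4 * γ)) =
          Real.sqrt 3 * ((σ ^ 3 * C) * ((N : ℝ) + 1) ^ (4 * γ)) := by ring
      rw [this]
      exact hti
    have hfix' : ∀ s ∈ Icc 0 t, ∀ x : T3, P N {z | F N s z x < 1} ≤ ENNReal.ofReal (δ N) := by
      intro s hs x
      have hset1 : {z | F N s z x < 1} =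
          {z | 1 / 2 < empiricalDensityField ((Φ N).flow s z) (fun y => φ N (y - x)) * σ ^ 3} := by
        ext z
        simp only [mem_setOf_eq, hevF1]
      rw [hset1]
      exact hfix N s hs x
    have hmain := floorChain_measure_le (P N) (Φ N).good configEnergy (K * ((N : ℝ) + 1)) (F N)
      (c₁ := 1) (by positivity) (Real.sqrt_nonneg _) ht hh hm (hmodF N) hsp' hti' hfix'
    refine hmain.trans (add_le_add le_rfl ?_)
    calc ((((⌊t / h⌋₊ + 1) * m ^ 3 : ℕ) : ℝ≥0∞)) * ENNReal.ofReal (δ N)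
        ≤ ENNReal.ofReal (((⌊t / h⌋₊ + 1) * m ^ 3 : ℕ) : ℝ) * ENNReal.ofReal |δ N| := by
          rw [ENNReal.ofReal_natCast]
          exact mul_le_mul' le_rfl (ENNReal.ofReal_le_ofReal (le_abs_self _))
      _ = ENNReal.ofReal ((((⌊t / h⌋₊ + 1) * m ^ 3 : ℕ) : ℝ) * |δ N|) :=
          (ENNReal.ofReal_mul (Nat.cast_nonneg _)).symm
      _ ≤ ENNReal.ofReal (A * (((N : ℝ) + 1) ^ 2 * |δ N|)) := by
          refine ENNReal.ofReal_le_ofReal ?_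
          rw [← mul_assoc]
          exact mul_le_mul_of_nonneg_right hcard (abs_nonneg _)
  -- the majorant tends to `0`
  have hlim : Tendsto (fun N : ℕ =>
      P N {z | z ∉ (Φ N).good ∨ K * ((N : ℝ) + 1) < configEnergy z} +
        ENNReal.ofReal (A * (((N : ℝ) + 1) ^ 2 * |δ N|))) atTop (𝓝 0) := by
    have h1 : Tendsto (fun N : ℕ => A * (((N : ℝ) + 1) ^ 2 * |δ N|)) atTop (𝓝 0) := by
      have h0 := (hδ.abs).const_mul A
      rw [abs_zero, mul_zero] at h0
      refine h0.congr fun N => ?_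
      rw [abs_mul, abs_of_nonneg (by positivity)]
    have h2 := ENNReal.tendsto_ofReal h1
    rw [ENNReal.ofReal_zero] at h2
    simpa using hcap.add h2
  exact tendsto_of_tendsto_of_tendsto_of_le_of_le tendsto_const_nhds hlim (fun N => zero_le) hbound

/-- **Fixed-point packing bound ⇒ half-ceiling, under the crux prefix.**  If for all profiles, `σ < σ₀`,
classical solutions tied at `t = 0`, horizons `t < T` in the chamber and admissible kernel families there is a
rate `δ_N`, `(N+1)²δ_N → 0`, with `P_N{1/2 < ρ̄_N(Φ_s z, x)σ³} ≤ δ_N` at every fixed `s ≤ t`, `x`, then the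
level-`1` half-ceiling holds along the flow: `P_N{∃ s ≤ t, ∃ x, 1 < ρ̄_N σ³} → 0` (`ceilingChain` fed by
the landed `stub_energyCap` and `stub_blockModulus`). -/
theorem halfCeiling_of_ceilingFixed :
    (∀ (a₀ θ₀ : T3 → ℝ) (u₀ : T3 → V3), Continuous a₀ → Continuous θ₀ → Continuous u₀ →
      (∀ x, 0 < a₀ x) → (∀ x, 0 < θ₀ x) →
      ∃ σ₀ : ℝ, 0 < σ₀ ∧ ∃ η₁ : ℝ, 0 < η₁ ∧ ∀ σ : ℝ, 0 < σ → σ < σ₀ →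
        ∀ (T : ℝ) (ρ θ : ℝ → T3 → ℝ) (u : ℝ → T3 → V3), IsHardSphereEulerSolution σ T ρ u θ →
        ∀ Φ : (N : ℕ) → HardSphereFlow (Torus.geometry (Fin 3)) (hsDiameter σ N) (N + 1),
          TendstoHydroFieldsAt (fun N => localGibbsLaw σ a₀ u₀ θ₀ N (Φ N)) Φ ρ u θ 0 →
          ∀ t : ℝ, 0 < t → t < T → (∀ s ∈ Icc 0 t, ∀ x, 2 * ρ s x * σ ^ 3 < η₁) →
            ∀ (γ C : ℝ) (φ : ℕ → T3 → ℝ), 0 < γ → γ ≤ 1 / 15 →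
              ((∀ N, Literature.Analysis.FunctionSpaces.Torus.IsSmooth (φ N)) ∧ (∀ N y, 0 ≤ φ N y) ∧
                (∀ N, ∫ y, φ N y = 1) ∧
                (∀ (N : ℕ) y, ((N : ℝ) + 1) ^ (-γ) ≤ Torus.euclidDist y 0 → φ N y = 0) ∧
                (∀ (N : ℕ) y, φ N y ≤ C * ((N : ℝ) + 1) ^ (3 * γ)) ∧
                (∀ (N : ℕ) y, ‖Literature.Analysis.FunctionSpaces.Torus.gradient (φ N) y‖ ≤
                  C * ((N : ℝ) + 1) ^ (4 * γ))) →
              ∃ δ : ℕ → ℝ, Tendsto (fun N : ℕ => ((N : ℝ) + 1) ^ 2 * δ N) atTop (𝓝 0) ∧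
                ∀ (N : ℕ), ∀ s ∈ Icc 0 t, ∀ x : T3,
                  localGibbsLaw σ a₀ u₀ θ₀ N (Φ N)
                      {z | 1 / 2 < empiricalDensityField ((Φ N).flow s z) (fun y => φ N (y - x)) * σ ^ 3} ≤
                    ENNReal.ofReal (δ N)) →
    (∀ (a₀ θ₀ : T3 → ℝ) (u₀ : T3 → V3), Continuous a₀ → Continuous θ₀ → Continuous u₀ →
      (∀ x, 0 < a₀ x) → (∀ x, 0 < θ₀ x) →
      ∃ σ₀ : ℝ, 0 < σ₀ ∧ ∃ η₁ : ℝ, 0 < η₁ ∧ ∀ σ : ℝ, 0 < σ → σ < σ₀ →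
        ∀ (T : ℝ) (ρ θ : ℝ → T3 → ℝ) (u : ℝ → T3 → V3), IsHardSphereEulerSolution σ T ρ u θ →
        ∀ Φ : (N : ℕ) → HardSphereFlow (Torus.geometry (Fin 3)) (hsDiameter σ N) (N + 1),
          TendstoHydroFieldsAt (fun N => localGibbsLaw σ a₀ u₀ θ₀ N (Φ N)) Φ ρ u θ 0 →
          ∀ t : ℝ, 0 < t → t < T → (∀ s ∈ Icc 0 t, ∀ x, 2 * ρ s x * σ ^ 3 < η₁) →
            ∀ (γ C : ℝ) (φ : ℕ → T3 → ℝ), 0 < γ → γ ≤ 1 / 15 →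
              ((∀ N, Literature.Analysis.FunctionSpaces.Torus.IsSmooth (φ N)) ∧ (∀ N y, 0 ≤ φ N y) ∧
                (∀ N, ∫ y, φ N y = 1) ∧
                (∀ (N : ℕ) y, ((N : ℝ) + 1) ^ (-γ) ≤ Torus.euclidDist y 0 → φ N y = 0) ∧
                (∀ (N : ℕ) y, φ N y ≤ C * ((N : ℝ) + 1) ^ (3 * γ)) ∧
                (∀ (N : ℕ) y, ‖Literature.Analysis.FunctionSpaces.Torus.gradient (φ N) y‖ ≤
                  C * ((N : ℝ) + 1) ^ (4 * γ))) →
              Tendsto (fun N : ℕ => localGibbsLaw σ a₀ u₀ θ₀ N (Φ N)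
                {z | ∃ s ∈ Icc 0 t, ∃ x : T3,
                  1 < empiricalDensityField ((Φ N).flow s z) (fun y => φ N (y - x)) * σ ^ 3})
                atTop (𝓝 0)) := by
  intro H a₀ θ₀ u₀ ha hθ hu ha0 hθ0
  obtain ⟨σ₀, hσ₀, η₁, hη₁, h⟩ := H a₀ θ₀ u₀ ha hθ hu ha0 hθ0
  refine ⟨σ₀, hσ₀, η₁, hη₁, fun σ hσ hσlt T ρ θ u hsol Φ hLLN t ht htT hdil γ C φ hγ hγ' hadm => ?_⟩
  obtain ⟨δ, hδ, hfix⟩ := h σ hσ hσlt T ρ θ u hsol Φ hLLN t ht htT hdil γ C φ hγ hγ' hadm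
  obtain ⟨K, hK, hcap⟩ := stub_energyCap a₀ θ₀ u₀ σ ρ θ u Φ hLLN
  have hC : 0 ≤ C := by
    have h0 := hadm.2.2.2.2.2 0 0
    simp only [Nat.cast_zero, zero_add, Real.one_rpow, mul_one] at h0
    exact (norm_nonneg _).trans h0
  have hmod : ∀ (N : ℕ), ∀ z ∈ (Φ N).good, configEnergy z ≤ K * ((N : ℝ) + 1) →
      ∀ (s s' : ℝ) (x x' : T3),
        |empiricalDensityField ((Φ N).flow s z) (fun y => φ N (y - x)) -
            empiricalDensityField ((Φ N).flow s' z) (fun y => φ N (y - x'))| ≤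
          Real.sqrt 3 * (C * ((N : ℝ) + 1) ^ (4 * γ)) * (‖x - x'‖ + |s - s'| * Real.sqrt (2 * K)) :=
    fun N z hz hE s s' x x' =>
      stub_blockModulus σ N (Φ N) (φ N) (C * ((N : ℝ) + 1) ^ (4 * γ)) K (hadm.1 N)
        (hadm.2.2.2.2.2 N) hK z hz hE s s' x x'
  exact ceilingChain σ Φ (fun N => localGibbsLaw σ a₀ u₀ θ₀ N (Φ N)) φ γ C t K δ hγ hγ' hC ht hK hσ.le
    hmod hcap hδ hfix

end Summit.AtomisticToContinuum.HydrodynamicLimit.Theorems.AdiabatCeiling
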